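import Mathlib.Tactic.NormNum.NatSqrt
import Mathlib.Tactic.IntervalCases
import Summits.ValiantsHypothesis.ValiantsHypothesis.Theorems.GrenetZeonDualUnipotentThreeHalvesHeavyTopPatternGeneral
import Summits.ValiantsHypothesis.ValiantsHypothesis.Theorems.DualUnipotentThreeHalves.Negative.HeavyTopInstThreeFive
import Summits.ValiantsHypothesis.ValiantsHypothesis.Theorems.DualUnipotentThreeHalves.Negative.HeavyTopInstFourSeven
import Summits.ValiantsHypothesis.ValiantsHypothesis.Theorems.DualUnipotentThreeHalves.Negative.HeavyTopInstFiveTen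
import Summits.ValiantsHypothesis.ValiantsHypothesis.Theorems.DualUnipotentThreeHalves.Negative.HeavyTopInstSevenFifteen
import Summits.ValiantsHypothesis.ValiantsHypothesis.Theorems.DualUnipotentThreeHalves.Negative.HeavyTopSlowInstPatterns

/-!
# `GrenetZeon.DualUnipotentThreeHalves` (stmt-ValiantsHypothesis-24318) — instance tables of R2 `HeavyTopLaw` / R2ᵖ `HeavyTopSlowLaw`, NEGATIVE lane:
# BLOCK PATHS — A UNIFORM PATH PLACEMENT AT `m ∼ n^{3/2}/√2`; EVERY ROW `n ≥ 3` OF THE `C₀ = 1` GRID HAS A ✗ CELL; ANY CONSTANT OF R2 / R2ᵖ IS `≥ 2`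

Experiment cell «val-heavytop-census» (D-0160), engine seat val-htc-eng-1 (g3), kit 0.  The census (CENSUS-GRID v0.8d) had the ✗ lower edge of the
`HeavyTopInst n m` grid row by row (`n ≤ 13`, now `≤ 16` with this seat's SAT placements), each by an explicit `decide`d path placement
(✓ `not_heavyTopInst_of_placement`, eng-2 g2).  A finite set of rows says nothing about the LAW `HeavyTopLaw = ∃ C₀ n₀, ∀ n ≥ n₀, …` (`n₀` is free).
This file gives ONE placement for ALL `n`, in closed form, and draws the law-level consequence.

**Construction (block paths).**  Fix `q` and distinct labels `(i_a, j_a)` with `i_a < j_a < q` (there are `C(q,2)` of them, ✓ `exists_triangle_labels`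
via `finSigmaFinEquiv`).  Cut `[0, m)` into consecutive blocks of length `q`.  Path `a` visits `i_a, j_a` in block `0`, then `i_a, j_a` in block `1`, …:
`V a k = q·⌊k/2⌋ + (i_a | j_a by parity of k)`, `k = 0 … s` — `s + 1` vertices in `⌊s/2⌋ + 1` blocks, so `m ≥ (⌊s/2⌋+1)·q` suffices.  An edge of path `a`
determines `(⌊k/2⌋, ⌊(k+1)/2⌋)` by the quotients mod `q`, hence `k`, and then `(i_a, j_a)` by the residues, hence `a`: the `s + 1` paths are
EDGE-DISJOINT with no search at all (✓ `exists_blockPaths_placement`; the `s + 1` extra entries are `(0, q + a)`, of length `≥ q`, while path edges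
have length `< q`).  With `s + 1 = n ≤ C(q,2)`, i.e. `q ≈ √(2n)`, this is a placement at `m = ⌈n/2⌉·q ∼ n^{3/2}/√2` — the τ-law constant: the
block count `τ(n,m)` and the placement criterion are LP-dual (CENSUS-PATTERN-CRITERION §1), and block paths realise the dual bound up to rounding
(exactly at `(6,12)` and `(10,25)`, where `n = C(q,2)`).

* ✓ `exists_triangle_labels`, ✓ `exists_blockPaths_placement` — the combinatorics (no `decide`, all `n`).
* ★★ `not_heavyTopInst_of_blockPaths` — `s+1 ≤ C(q,2)`, `(⌊s/2⌋+1)q ≤ m`, `q + s < m`, `(s+1)² ≤ 16m√(s+1) + 16(s+1)` ⟹ `¬ HeavyTopInst (s+1) m`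
  (✓ `not_heavyTopInst_of_placement_general`); ★★ `exists_not_slow_of_blockPaths` — the same in POWER currency (✓ `exists_not_slow_of_placement_general`).
* ★★ `exists_not_heavyTopInst_sliver_of_le` — rows `n ≥ 18` uniformly with `q = ⌊√(2n)⌋ + 2`, `m = (⌊(n−1)/2⌋+1)·q`, and `m² < n³` PROVED (elementary
  estimates on `Nat.sqrt`); ★★ `exists_not_heavyTopInst_sliver` / `exists_not_slow_sliver` — **EVERY row `n ≥ 3` has a cell `(n, m)`, `m² < n³`, that is
  ✗ in flag / power currency** (rows `3,4,5,7` are the census cells ✓ p635270 / p648631 / p679227 / p679229 / p681063, rows `6, 8–17` block paths by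
  `norm_num`, rows `≥ 18` the uniform lemma).
* ★★★ `not_heavyTopInst_family_one`, `not_heavyTopSlowInst_family_one` — for EVERY `n₀` the instance family of R2 (resp. R2ᵖ) with `C₀ = 1` is
  FALSE; ★★★ `two_le_of_heavyTopLaw_witness`, `two_le_of_heavyTopSlowLaw_witness` — **any constant `C₀` witnessing `HeavyTopLaw` / `HeavyTopSlowLaw`
  (with any `n₀`) satisfies `C₀ ≥ 2`**; `heavyTopLaw_iff_two_le`, `heavyTopSlowLaw_iff_two_le` — the laws restated with the priced constant.

SHARPNESS OF THE METHOD.  Block paths sit at `n³/m² → 2⁺`; a strictly upper (pattern) pencil can never refute a cell with `τ(n,m) < n²` (τ-law,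
✓ p658845 `CoarseFlagLaw` side: triangularisable tops are weight-thin there), and `τ(n,m) < n²` contains `2m² < n³` asymptotically — so `C₀ = 2` is
exactly where coordinate patterns stop; deciding the `C₀ ≥ 2` cells is the ι-question / per-space side of the census (GRID §B), untouched here.

HONEST LABEL.  This PRICES the constant of R2 / R2ᵖ (`C₀ ≥ 2` is necessary); it does NOT refute `HeavyTopLaw` or `HeavyTopSlowLaw` (`∃ C₀ n₀`),
nor S3b, IRR/RED, the crux 24318, rung 8062 or `VP ≠ VNP` — all OPEN / NOT moved.  `--supports stmt-ValiantsHypothesis-24318` (Negative path).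
[CENSUS-PATTERN-CRITERION.md (eng-2 g2: criterion, duality remark); CENSUS-GRID.md v0.8d §0 A «every ✗ sits at m*_tri(n)+1, all at C₀ = 1»; this seat]
-/

-- `Summit.ValiantsHypothesis.ValiantsHypothesis.…` repeats a component (D-0017 layout); `dupNamespace` would flag the mandated name.
set_option linter.dupNamespace false
set_option autoImplicit false

noncomputable section

namespace Summit.ValiantsHypothesis.ValiantsHypothesis.Theorems.GrenetZeon.RadicalSplit

open Summit.ValiantsHypothesis.ValiantsHypothesis.Cruxes.TwoDimCoefficients.DimTwoCases (AffMat IsAffine)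
open Summit.ValiantsHypothesis.ValiantsHypothesis.Theorems.GrenetZeon.SlowCore (Slow HeavyTopSlowLaw)

section BlockPaths

variable {s q m : ℕ}

/-! ## §1 Triangle labels: `s + 1 ≤ C(q,2)` injective labels `a ↦ (i_a, j_a)`, `i_a < j_a < q` -/

/-- `∑_{j < q} j = q (q−1)/2` over `Fin q`. -/
theorem sum_fin_val_eq_choose (q : ℕ) : (∑ j : Fin q, (j : ℕ)) = q * (q - 1) / 2 := by
  have h1 : (∑ j : Fin q, (j : ℕ)) = ∑ j ∈ Finset.range q, j := Fin.sum_univ_eq_sum_range (fun j => j) q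
  have h2 := Finset.sum_range_id_mul_two q
  omega

/-- **Triangle labels.**  If `s + 1 ≤ q(q−1)/2` there are `s + 1` distinct pairs `(i, j)` with `i < j < q`. -/
theorem exists_triangle_labels (h : s + 1 ≤ q * (q - 1) / 2) :
    ∃ lab : Fin (s + 1) → Fin q × Fin q, Function.Injective lab ∧ ∀ a, (lab a).1 < (lab a).2 := by
  rw [← sum_fin_val_eq_choose] at h
  let e : Fin (s + 1) → (j : Fin q) × Fin (j : ℕ) := fun a => finSigmaFinEquiv.symm (Fin.castLE h a)
  have he : Function.Injective e := finSigmaFinEquiv.symm.injective.comp (Fin.castLE_injective h)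
  refine ⟨fun a => (⟨((e a).2 : ℕ), lt_trans (e a).2.isLt (e a).1.isLt⟩, (e a).1), ?_, fun a => (e a).2.isLt⟩
  intro a b hab
  simp only [Prod.mk.injEq, Fin.mk.injEq] at hab
  apply he
  exact Sigma.ext hab.2 ((Fin.heq_ext_iff (by rw [hab.2])).2 hab.1)

/-! ## §2 The block-path placement -/

/-- **The block-path placement.**  Given `s + 1` distinct labels `(i_a, j_a)`, `i_a < j_a < q`, the vertex rows
`V a k = q·⌊k/2⌋ + (i_a if k even, j_a if k odd)` (`k = 0 … s`) are `s + 1` EDGE-DISJOINT directed `s`-paths of the complete DAG on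
`m ≥ (⌊s/2⌋ + 1)·q` vertices, and together with the `s + 1` entries `(0, q + a)` they form an injective strictly upper placement.
Edge-disjointness: an edge `(V a k, V a (k+1))` determines `(⌊k/2⌋, ⌊(k+1)/2⌋)` (quotients by `q`), hence `k`, and the residues
`{i_a, j_a}` in the order dictated by the parity of `k`, hence `a`; path edges have length `< q`, the extra entries length `≥ q`. -/
theorem exists_blockPaths_placement (lab : Fin (s + 1) → Fin q × Fin q) (hinj : Function.Injective lab)
    (hlt : ∀ a, (lab a).1 < (lab a).2) (hm : (s / 2 + 1) * q ≤ m) (hX : q + s < m) :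
    ∃ (V : Fin (s + 1) → Fin (s + 1) → Fin m) (X : Fin (s + 1) → Fin m × Fin m),
      Function.Injective (placement V X) ∧ ∀ c, (placement V X c).1 < (placement V X c).2 := by
  -- the residue at position `k` of path `a`
  set r : Fin (s + 1) → ℕ → ℕ := fun a k => if k % 2 = 0 then ((lab a).1 : ℕ) else ((lab a).2 : ℕ) with hr
  have hrq : ∀ a k, r a k < q := by
    intro a k
    simp only [hr]
    split_ifs
    · exact (lab a).1.isLt
    · exact (lab a).2.isLt
  have hq : 0 < q := lt_of_le_of_lt (Nat.zero_le _) (lab 0).2.isLt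
  have hval_lt : ∀ (a : Fin (s + 1)) (k : Fin (s + 1)), r a k + q * ((k : ℕ) / 2) < m := by
    intro a k
    have hk : (k : ℕ) / 2 + 1 ≤ s / 2 + 1 := by have := k.isLt; omega
    have h1 : q * ((k : ℕ) / 2) + q ≤ (s / 2 + 1) * q := by
      have := Nat.mul_le_mul_right q hk
      rw [Nat.add_mul, one_mul, mul_comm] at this
      exact this
    have := hrq a k
    omega
  -- quotient and residue by `q`
  have hdiv : ∀ a (k : ℕ), (r a k + q * (k / 2)) / q = k / 2 := fun a k => by
    rw [Nat.add_mul_div_left _ _ hq, Nat.div_eq_of_lt (hrq a k), zero_add]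
  have hmod : ∀ a (k : ℕ), (r a k + q * (k / 2)) % q = r a k := fun a k => by
    rw [Nat.add_mul_mod_self_left, Nat.mod_eq_of_lt (hrq a k)]
  -- residues at consecutive positions, by parity
  have hr_even : ∀ a t, r a (2 * t) = (lab a).1 ∧ r a (2 * t + 1) = (lab a).2 := by
    intro a t
    have e1 : (2 * t) % 2 = 0 := by omega
    have e2 : ¬ ((2 * t + 1) % 2 = 0) := by omega
    simp only [hr, e1, e2, if_true, if_false, and_self]
  have hr_odd : ∀ a t, r a (2 * t + 1) = (lab a).2 ∧ r a (2 * t + 1 + 1) = (lab a).1 := by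
    intro a t
    have e1 : ¬ ((2 * t + 1) % 2 = 0) := by omega
    have e2 : (2 * t + 1 + 1) % 2 = 0 := by omega
    simp only [hr, e1, e2, if_true, if_false, and_self]
  -- one step along a path: strictly increasing, by less than `q`
  have hstep : ∀ a (k : ℕ), r a k + q * (k / 2) < r a (k + 1) + q * ((k + 1) / 2) ∧
      r a (k + 1) + q * ((k + 1) / 2) < r a k + q * (k / 2) + q := by
    intro a k
    have hi : ((lab a).1 : ℕ) < (lab a).2 := hlt a
    have hj : ((lab a).2 : ℕ) < q := (lab a).2.isLt
    obtain ⟨t, rfl | rfl⟩ := Nat.even_or_odd' k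
    · have d1 : 2 * t / 2 = t := by omega
      have d2 : (2 * t + 1) / 2 = t := by omega
      rw [d1, d2, (hr_even a t).1, (hr_even a t).2]
      constructor <;> omega
    · have d1 : (2 * t + 1) / 2 = t := by omega
      have d2 : (2 * t + 1 + 1) / 2 = t + 1 := by omega
      rw [d1, d2, (hr_odd a t).1, (hr_odd a t).2, Nat.mul_succ]
      constructor <;> omega
  refine ⟨fun a k => ⟨r a k + q * ((k : ℕ) / 2), hval_lt a k⟩,
    fun a => (⟨0, by omega⟩, ⟨q + a, by have := a.isLt; omega⟩), ?_, ?_⟩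
  · -- injectivity of the placement
    intro c d hcd
    unfold placement at hcd
    split_ifs at hcd with hc hd hd
    · -- two path edges
      simp only [Prod.mk.injEq, Fin.mk.injEq] at hcd
      obtain ⟨h1, h2⟩ := hcd
      have q1 := congrArg (· / q) h1
      have q2 := congrArg (· / q) h2
      have m1 := congrArg (· % q) h1
      have m2 := congrArg (· % q) h2
      simp only [hdiv, hmod] at q1 q2 m1 m2
      have hk : (c.2 : ℕ) = d.2 := by omega
      have hlab : lab c.1 = lab d.1 := by
        obtain ⟨t, ht | ht⟩ := Nat.even_or_odd' (c.2 : ℕ)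
        · rw [← hk, ht, (hr_even c.1 t).1, (hr_even d.1 t).1] at m1
          rw [← hk, ht, (hr_even c.1 t).2, (hr_even d.1 t).2] at m2
          exact Prod.ext (Fin.ext m1) (Fin.ext m2)
        · rw [← hk, ht, (hr_odd c.1 t).1, (hr_odd d.1 t).1] at m1
          rw [← hk, ht, (hr_odd c.1 t).2, (hr_odd d.1 t).2] at m2
          exact Prod.ext (Fin.ext m2) (Fin.ext m1)
      exact Prod.ext (hinj hlab) (Fin.ext hk)
    · -- `c` a path edge, `d` an extra entry: lengths `< q` vs `≥ q`
      exfalso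
      simp only [Prod.mk.injEq, Fin.mk.injEq] at hcd
      have := (hstep c.1 (c.2 : ℕ)).2
      omega
    · -- `c` an extra entry, `d` a path edge
      exfalso
      simp only [Prod.mk.injEq, Fin.mk.injEq] at hcd
      have := (hstep d.1 (d.2 : ℕ)).2
      omega
    · -- two extra entries
      simp only [Prod.mk.injEq, Fin.mk.injEq] at hcd
      have hc' := c.2.isLt
      have hd' := d.2.isLt
      exact Prod.ext (Fin.ext (by omega)) (Fin.ext (by omega))
  · -- strictly upper
    intro c
    unfold placement
    split_ifs with hc
    · exact Fin.mk_lt_mk.2 (hstep c.1 (c.2 : ℕ)).1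
    · exact Fin.mk_lt_mk.2 (by omega)

/-- **THE UNIFORM ✗ CRITERION (flag currency).**  If `s + 1 ≤ C(q, 2)`, `(⌊s/2⌋ + 1)·q ≤ m`, `q + s < m` and the numeric heavy-top
inequality `(s+1)² ≤ 16 m √(s+1) + 16 (s+1)` holds, then `HeavyTopInst (s+1) m` is FALSE — witnessed by the pattern pencil of the block-path
placement (✓ `not_heavyTopInst_of_placement_general`). [this file] -/
theorem not_heavyTopInst_of_blockPaths (hn : s + 1 ≤ q * (q - 1) / 2) (hm : (s / 2 + 1) * q ≤ m) (hX : q + s < m)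
    (hnum : (s + 1) * (s + 1) ≤ 16 * m * Nat.sqrt (s + 1) + 16 * (s + 1)) : ¬ HeavyTopInst (s + 1) m := by
  obtain ⟨lab, hinj, hlt⟩ := exists_triangle_labels hn
  obtain ⟨V, X, hpl, hup⟩ := exists_blockPaths_placement lab hinj hlt hm hX
  exact not_heavyTopInst_of_placement_general hnum V X hpl hup

/-- **THE UNIFORM ✗ CRITERION (power currency).**  Under the same hypotheses the `(s+1, m)` instance of R2ᵖ `HeavyTopSlowLaw` is false:
an affine nilpotent heavy-top pencil that is not `Slow`. [this file; ✓ `exists_not_slow_of_placement_general`] -/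
theorem exists_not_slow_of_blockPaths (hn : s + 1 ≤ q * (q - 1) / 2) (hm : (s / 2 + 1) * q ≤ m) (hX : q + s < m)
    (hnum : (s + 1) * (s + 1) ≤ 16 * m * Nat.sqrt (s + 1) + 16 * (s + 1)) :
    ∃ N : AffMat (s + 1) m, IsAffine N ∧ N ^ m = 0 ∧
      (∀ K : Submodule ℂ (Fin (s + 1) × Fin (s + 1) → ℂ), RadOrth (s + 1) m N K →
        Module.finrank ℂ K ≤ 16 * m * Nat.sqrt (s + 1) + 16 * (s + 1)) ∧ ¬ Slow (s + 1) m N := by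
  obtain ⟨lab, hinj, hlt⟩ := exists_triangle_labels hn
  obtain ⟨V, X, hpl, hup⟩ := exists_blockPaths_placement lab hinj hlt hm hX
  exact exists_not_slow_of_placement_general hnum V X hpl hup

end BlockPaths

/-! ## §3 Every row of the `C₀ = 1` grid has a ✗ cell -/

section EveryRow

/-- **Rows `n ≥ 18`, uniformly**: with `r = ⌊√(2n)⌋`, `q = r + 2` and `m = (⌊(n−1)/2⌋ + 1)·q` one has `m² < n³`, and the block-path
placement refutes the `(n, m)` instance in BOTH currencies.  (`m ∼ n^{3/2}/√2`: the construction sits at `n³/m² → 2`.) [this file] -/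
theorem exists_not_heavyTopInst_sliver_of_le {n : ℕ} (hn : 18 ≤ n) :
    ∃ m : ℕ, 1 * m ^ 2 < n ^ 3 ∧ ¬ HeavyTopInst n m ∧
      ∃ N : AffMat n m, IsAffine N ∧ N ^ m = 0 ∧
        (∀ K : Submodule ℂ (Fin n × Fin n → ℂ), RadOrth n m N K → Module.finrank ℂ K ≤ 16 * m * Nat.sqrt n + 16 * n) ∧
        ¬ Slow n m N := by
  obtain ⟨s, rfl⟩ : ∃ s, n = s + 1 := ⟨n - 1, by omega⟩
  -- the two integer square roots in play
  set r := Nat.sqrt (2 * (s + 1)) with hr_def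
  set t := Nat.sqrt (s + 1) with ht_def
  have F1 : r * r ≤ 2 * (s + 1) := Nat.sqrt_le _
  have F2 : 2 * (s + 1) < (r + 1) * (r + 1) := Nat.lt_succ_sqrt _
  have G2 : s + 1 < (t + 1) * (t + 1) := Nat.lt_succ_sqrt _
  have G3 : t ≤ r := Nat.sqrt_le_sqrt (by omega)
  have hr6 : 6 ≤ r := by
    by_contra h
    have : (r + 1) * (r + 1) ≤ 6 * 6 := Nat.mul_le_mul (by omega) (by omega)
    omega
  have hrs : r ≤ 2 * (s + 1) := le_trans (Nat.le_mul_self r) F1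
  -- (a) enough labels: `s + 1 ≤ C(r+2, 2)`
  have hlab : s + 1 ≤ (r + 2) * (r + 2 - 1) / 2 := by
    rw [show r + 2 - 1 = r + 1 by omega, Nat.le_div_iff_mul_le (by norm_num)]
    nlinarith [F2]
  -- (c) room for the extra entries
  have h8 : (s / 2 + 1) * 8 ≤ (s / 2 + 1) * (r + 2) := Nat.mul_le_mul_left _ (by omega)
  have hX : r + 2 + s < (s / 2 + 1) * (r + 2) := by omega
  -- (d) the numeric heavy-top inequality `n² ≤ 16 m √n + 16 n`
  have hnum : (s + 1) * (s + 1) ≤ 16 * ((s / 2 + 1) * (r + 2)) * Nat.sqrt (s + 1) + 16 * (s + 1) := by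
    rw [← ht_def]
    have d1 : (s / 2 + 1) * (t + 2) ≤ (s / 2 + 1) * (r + 2) := Nat.mul_le_mul_left _ (by omega)
    have d2 : 16 * ((s / 2 + 1) * (t + 2)) * t ≤ 16 * ((s / 2 + 1) * (r + 2)) * t :=
      Nat.mul_le_mul_right _ (Nat.mul_le_mul_left _ d1)
    have d3 : (s + 1) * (s + 1) ≤ (s + 1) * (t * t + 2 * t) := Nat.mul_le_mul_left _ (by nlinarith [G2])
    have d4 : (s + 1) * (t * t + 2 * t) ≤ 2 * (s / 2 + 1) * (t * t + 2 * t) := Nat.mul_le_mul_right _ (by omega)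
    have d5 : 2 * (s / 2 + 1) * (t * t + 2 * t) ≤ 16 * ((s / 2 + 1) * (t + 2)) * t := by
      have : 2 * (s / 2 + 1) * (t * t + 2 * t) = 2 * (((s / 2 + 1) * (t + 2)) * t) := by ring
      rw [this]
      nlinarith
    omega
  -- (e) the cell is in the `C₀ = 1` sliver: `m² < n³` (needs `n ≥ 18`)
  have hsl : 1 * ((s / 2 + 1) * (r + 2)) ^ 2 < (s + 1) ^ 3 := by
    have e1 : 12 * r ≤ r * r + 36 := by nlinarith [Nat.zero_le ((r - 6) * (r - 6)), Nat.sub_add_cancel hr6]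
    have e2 : 3 * ((r + 2) * (r + 2)) ≤ 8 * (s + 1) + 48 := by nlinarith [e1, F1]
    have e3 : 2 * (s / 2 + 1) ≤ s + 2 := by omega
    have e4 : (2 * (s / 2 + 1)) * (2 * (s / 2 + 1)) ≤ (s + 2) * (s + 2) := Nat.mul_le_mul e3 e3
    have e5 : 12 * ((s / 2 + 1) * (r + 2)) ^ 2 ≤ (s + 2) * (s + 2) * (8 * (s + 1) + 48) := by
      have : 12 * ((s / 2 + 1) * (r + 2)) ^ 2 = ((2 * (s / 2 + 1)) * (2 * (s / 2 + 1))) * (3 * ((r + 2) * (r + 2))) := by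
        ring
      rw [this]
      exact Nat.mul_le_mul e4 e2
    have e6 : 18 * ((s + 1) * (s + 1)) ≤ (s + 1) * ((s + 1) * (s + 1)) := Nat.mul_le_mul_right _ (by omega)
    have e7 : 18 * (s + 1) ≤ (s + 1) * (s + 1) := Nat.mul_le_mul_right _ (by omega)
    nlinarith [e5, e6, e7]
  refine ⟨(s / 2 + 1) * (r + 2), hsl, not_heavyTopInst_of_blockPaths hlab le_rfl hX hnum,
    exists_not_slow_of_blockPaths hlab le_rfl hX hnum⟩

/-- ★★ **EVERY ROW `n ≥ 3` OF THE `C₀ = 1` GRID HAS A ✗ CELL (flag currency)**: for every `n ≥ 3` there is an `m` with `m² < n³` and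
`¬ HeavyTopInst n m`.  Rows `3, 4, 5, 7`: the census cells `(3,5)` ✓ p635270, `(4,7)` ✓ p648631, `(5,10)` ✓ p679227, `(7,15)` ✓ p679229;
rows `6` and `8 … 17`: block paths with the table's `(q, m)`; rows `≥ 18`: ✓ `exists_not_heavyTopInst_sliver_of_le`. [this file] -/
theorem exists_not_heavyTopInst_sliver {n : ℕ} (hn : 3 ≤ n) : ∃ m : ℕ, 1 * m ^ 2 < n ^ 3 ∧ ¬ HeavyTopInst n m := by
  by_cases h18 : 18 ≤ n
  · obtain ⟨m, h1, h2, -⟩ := exists_not_heavyTopInst_sliver_of_le h18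
    exact ⟨m, h1, h2⟩
  · interval_cases n
    · exact ⟨5, by norm_num, not_heavyTopInst_three_five⟩
    · exact ⟨7, by norm_num, not_heavyTopInst_four_seven⟩
    · exact ⟨10, by norm_num, not_heavyTopInst_five_ten⟩
    · exact ⟨12, by norm_num, not_heavyTopInst_of_blockPaths (s := 5) (q := 4) (by norm_num) (by norm_num) (by norm_num) (by norm_num)⟩
    · exact ⟨15, by norm_num, not_heavyTopInst_seven_fifteen⟩
    · exact ⟨20, by norm_num, not_heavyTopInst_of_blockPaths (s := 7) (q := 5) (by norm_num) (by norm_num) (by norm_num) (by norm_num)⟩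
    · exact ⟨25, by norm_num, not_heavyTopInst_of_blockPaths (s := 8) (q := 5) (by norm_num) (by norm_num) (by norm_num) (by norm_num)⟩
    · exact ⟨25, by norm_num, not_heavyTopInst_of_blockPaths (s := 9) (q := 5) (by norm_num) (by norm_num) (by norm_num) (by norm_num)⟩
    · exact ⟨36, by norm_num, not_heavyTopInst_of_blockPaths (s := 10) (q := 6) (by norm_num) (by norm_num) (by norm_num) (by norm_num)⟩
    · exact ⟨36, by norm_num, not_heavyTopInst_of_blockPaths (s := 11) (q := 6) (by norm_num) (by norm_num) (by norm_num) (by norm_num)⟩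
    · exact ⟨42, by norm_num, not_heavyTopInst_of_blockPaths (s := 12) (q := 6) (by norm_num) (by norm_num) (by norm_num) (by norm_num)⟩
    · exact ⟨42, by norm_num, not_heavyTopInst_of_blockPaths (s := 13) (q := 6) (by norm_num) (by norm_num) (by norm_num) (by norm_num)⟩
    · exact ⟨48, by norm_num, not_heavyTopInst_of_blockPaths (s := 14) (q := 6) (by norm_num) (by norm_num) (by norm_num) (by norm_num)⟩
    · exact ⟨56, by norm_num, not_heavyTopInst_of_blockPaths (s := 15) (q := 7) (by norm_num) (by norm_num) (by norm_num) (by norm_num)⟩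
    · exact ⟨63, by norm_num, not_heavyTopInst_of_blockPaths (s := 16) (q := 7) (by norm_num) (by norm_num) (by norm_num) (by norm_num)⟩

/-- ★★ **EVERY ROW `n ≥ 3` HAS A ✗ CELL IN POWER CURRENCY TOO**: an affine nilpotent heavy-top `N` with `m² < n³` and `¬ Slow n m N`.
Rows `3, 4, 5, 7` from ✓ `…Negative.HeavyTopSlowInstPatterns` (p681063), the rest by block paths. [this file] -/
theorem exists_not_slow_sliver {n : ℕ} (hn : 3 ≤ n) :
    ∃ m : ℕ, 1 * m ^ 2 < n ^ 3 ∧ ∃ N : AffMat n m, IsAffine N ∧ N ^ m = 0 ∧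
      (∀ K : Submodule ℂ (Fin n × Fin n → ℂ), RadOrth n m N K → Module.finrank ℂ K ≤ 16 * m * Nat.sqrt n + 16 * n) ∧
      ¬ Slow n m N := by
  by_cases h18 : 18 ≤ n
  · obtain ⟨m, h1, -, h3⟩ := exists_not_heavyTopInst_sliver_of_le h18
    exact ⟨m, h1, h3⟩
  · interval_cases n
    · exact ⟨5, by norm_num, heavyTopSlowInst_false_three_five⟩
    · exact ⟨7, by norm_num, heavyTopSlowInst_false_four_seven⟩
    · exact ⟨10, by norm_num, heavyTopSlowInst_false_five_ten⟩
    · exact ⟨12, by norm_num, exists_not_slow_of_blockPaths (s := 5) (q := 4) (by norm_num) (by norm_num) (by norm_num) (by norm_num)⟩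
    · exact ⟨15, by norm_num, heavyTopSlowInst_false_seven_fifteen⟩
    · exact ⟨20, by norm_num, exists_not_slow_of_blockPaths (s := 7) (q := 5) (by norm_num) (by norm_num) (by norm_num) (by norm_num)⟩
    · exact ⟨25, by norm_num, exists_not_slow_of_blockPaths (s := 8) (q := 5) (by norm_num) (by norm_num) (by norm_num) (by norm_num)⟩
    · exact ⟨25, by norm_num, exists_not_slow_of_blockPaths (s := 9) (q := 5) (by norm_num) (by norm_num) (by norm_num) (by norm_num)⟩
    · exact ⟨36, by norm_num, exists_not_slow_of_blockPaths (s := 10) (q := 6) (by norm_num) (by norm_num) (by norm_num) (by norm_num)⟩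
    · exact ⟨36, by norm_num, exists_not_slow_of_blockPaths (s := 11) (q := 6) (by norm_num) (by norm_num) (by norm_num) (by norm_num)⟩
    · exact ⟨42, by norm_num, exists_not_slow_of_blockPaths (s := 12) (q := 6) (by norm_num) (by norm_num) (by norm_num) (by norm_num)⟩
    · exact ⟨42, by norm_num, exists_not_slow_of_blockPaths (s := 13) (q := 6) (by norm_num) (by norm_num) (by norm_num) (by norm_num)⟩
    · exact ⟨48, by norm_num, exists_not_slow_of_blockPaths (s := 14) (q := 6) (by norm_num) (by norm_num) (by norm_num) (by norm_num)⟩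
    · exact ⟨56, by norm_num, exists_not_slow_of_blockPaths (s := 15) (q := 7) (by norm_num) (by norm_num) (by norm_num) (by norm_num)⟩
    · exact ⟨63, by norm_num, exists_not_slow_of_blockPaths (s := 16) (q := 7) (by norm_num) (by norm_num) (by norm_num) (by norm_num)⟩

end EveryRow

/-! ## §4 Law-level consequence: the constant of R2 / R2ᵖ is at least `2` -/

section Constant

/-- ★★★ **R2's instance family is FALSE at `C₀ = 1` for EVERY threshold `n₀`** — the body of `HeavyTopLaw` (✓ `heavyTopLaw_iff_inst`) cannot be
witnessed with `C₀ = 1`: the block-path pattern pencils refute a cell of the `C₀ = 1` sliver in every row `n ≥ 3`.  (Before this file the census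
knew it row by row for `n ≤ 13`, which says nothing about the law, `n₀` being free.)  NOT a refutation of `HeavyTopLaw` (`∃ C₀ n₀`): it prices the
constant. [this file] -/
theorem not_heavyTopInst_family_one (n₀ : ℕ) : ¬ ∀ n ≥ n₀, ∀ m : ℕ, 1 * m ^ 2 < n ^ 3 → HeavyTopInst n m := by
  intro h
  obtain ⟨m, hm, hnot⟩ := exists_not_heavyTopInst_sliver (n := max n₀ 3) (le_max_right _ _)
  exact hnot (h _ (le_max_left _ _) m hm)

/-- ★★★ **ANY CONSTANT WITNESSING R2 `HeavyTopLaw` IS `≥ 2`.**  (`C₀ = 0` admits every `m`, `C₀ = 1` is ✓ `not_heavyTopInst_family_one`.)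
Sharpness of the method: the block paths sit at `n³/m² → 2⁺`, and no strictly upper pattern can refute a cell with `τ(n,m) < n²` (τ-law ✓ p658845),
which covers `2m² < n³` asymptotically — so `2` is exactly where coordinate patterns stop. [this file] -/
theorem two_le_of_heavyTopLaw_witness {C₀ n₀ : ℕ} (h : ∀ n ≥ n₀, ∀ m : ℕ, C₀ * m ^ 2 < n ^ 3 → HeavyTopInst n m) : 2 ≤ C₀ := by
  by_contra hC
  apply not_heavyTopInst_family_one n₀
  intro n hn m hm
  refine h n hn m (lt_of_le_of_lt ?_ hm)
  exact Nat.mul_le_mul_right _ (by omega)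

/-- `HeavyTopLaw` restated with the priced constant: R2 holds iff it holds with some `C₀ ≥ 2`. [this file; `HeavyTopLaw` is its instance family by `Iff.rfl`, ✓ `heavyTopLaw_iff_inst`] -/
theorem heavyTopLaw_iff_two_le :
    HeavyTopLaw ↔ ∃ C₀ n₀ : ℕ, 2 ≤ C₀ ∧ ∀ n ≥ n₀, ∀ m : ℕ, C₀ * m ^ 2 < n ^ 3 → HeavyTopInst n m := by
  constructor
  · rintro ⟨C₀, n₀, h⟩
    exact ⟨C₀, n₀, two_le_of_heavyTopLaw_witness h, h⟩
  · rintro ⟨C₀, n₀, -, h⟩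
    exact ⟨C₀, n₀, h⟩

/-- ★★★ **R2ᵖ's instance family is FALSE at `C₀ = 1` for every `n₀`** (power currency; body of `HeavyTopSlowLaw`). [this file] -/
theorem not_heavyTopSlowInst_family_one (n₀ : ℕ) :
    ¬ ∀ n ≥ n₀, ∀ m : ℕ, 1 * m ^ 2 < n ^ 3 → ∀ N : AffMat n m, IsAffine N → N ^ m = 0 →
      (∀ K : Submodule ℂ (Fin n × Fin n → ℂ), RadOrth n m N K → Module.finrank ℂ K ≤ 16 * m * Nat.sqrt n + 16 * n) →
      Slow n m N := by
  intro h
  obtain ⟨m, hm, N, hN, hnil, htop, hnot⟩ := exists_not_slow_sliver (n := max n₀ 3) (le_max_right _ _)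
  exact hnot (h _ (le_max_left _ _) m hm N hN hnil htop)

/-- ★★★ **ANY CONSTANT WITNESSING R2ᵖ `HeavyTopSlowLaw` IS `≥ 2`.** [this file] -/
theorem two_le_of_heavyTopSlowLaw_witness {C₀ n₀ : ℕ}
    (h : ∀ n ≥ n₀, ∀ m : ℕ, C₀ * m ^ 2 < n ^ 3 → ∀ N : AffMat n m, IsAffine N → N ^ m = 0 →
      (∀ K : Submodule ℂ (Fin n × Fin n → ℂ), RadOrth n m N K → Module.finrank ℂ K ≤ 16 * m * Nat.sqrt n + 16 * n) →
      Slow n m N) : 2 ≤ C₀ := by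
  by_contra hC
  apply not_heavyTopSlowInst_family_one n₀
  intro n hn m hm
  refine h n hn m (lt_of_le_of_lt ?_ hm)
  exact Nat.mul_le_mul_right _ (by omega)

/-- `HeavyTopSlowLaw` restated with the priced constant. [this file] -/
theorem heavyTopSlowLaw_iff_two_le :
    HeavyTopSlowLaw ↔ ∃ C₀ n₀ : ℕ, 2 ≤ C₀ ∧ ∀ n ≥ n₀, ∀ m : ℕ, C₀ * m ^ 2 < n ^ 3 → ∀ N : AffMat n m, IsAffine N → N ^ m = 0 →
      (∀ K : Submodule ℂ (Fin n × Fin n → ℂ), RadOrth n m N K → Module.finrank ℂ K ≤ 16 * m * Nat.sqrt n + 16 * n) →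
      Slow n m N := by
  constructor
  · rintro ⟨C₀, n₀, h⟩
    exact ⟨C₀, n₀, two_le_of_heavyTopSlowLaw_witness h, h⟩
  · rintro ⟨C₀, n₀, -, h⟩
    exact ⟨C₀, n₀, h⟩

end Constant

end Summit.ValiantsHypothesis.ValiantsHypothesis.Theorems.GrenetZeon.RadicalSplit

end
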